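import Literature.AlgebraicGeometry.HodgeTheory.PencilSpreadDescent
import Literature.AlgebraicGeometry.HodgeTheory.LefschetzPencilHyperplaneSectionsProofs
import Literature.AlgebraicGeometry.HodgeTheory.SpreadAlgebraicClassesPencil
import HarnessLib

/-!
# The pencil step below the middle dimension, from the pencil spreading fact

Family `hodge`, layer `Literature/AlgebraicGeometry/HodgeTheory`. Theorems only (no definitions, no
named facts, D-0026).

**If the Hodge conjecture holds for all smooth projective complex `m`-folds (rational `(q,q)`-classes
are algebraic, all `q`), then on every smooth projective `(m+1)`-fold `X` every rational
`(p,p)`-class of degree `2p ≤ m` is algebraic — GRANTED the spreading of fibrewise algebraic classes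
over a pencil**, the tree's named fact `spread_algebraicClasses_over_projectiveLine`
(`HodgeTheory/SpreadAlgebraicClassesPencil`; relative Hilbert schemes, countability, a dominating
component, a multisection: Voisin II §3.3.1 and §10.2.1), or its two Hilbert-scheme-free leaves
`spread_supports_over_projectiveLine` (I) and `vertical_rigidity_supportedClasses_projectiveLine`
(II) (`spread_algebraicClasses_of_supports_of_rigidity : (I) → (II) → fact`, proved there).

This is the Lefschetz-pencil step of the induction on the dimension of de Cataldo–Migliorini
(arXiv:0711.1307v1 §4, proof of Prop. 4.5, pp. 10–11: "Assume we have done the case `d − 1`. […]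
Using a Lefschetz pencil we deal with `Hᵏ(X)`, `k ≤ d − 1`. Here is how. Take a nice Lefschetz
pencil `X ← X̃ → ℙ¹` […] By induction we have HC for `X_t` […] Take `Hilb(X̃/ℙ¹)` […] It follows
that `u^* a` is algebraic") and of Thomas (2005, proof of Prop. 2, case `k < d/2`, p. 4), i.e. the
body of the tree's named fact `deCataldoMigliorini2009_mem_algebraicClasses_of_two_mul_le`
(`HodgeTheory/PencilStepBelowMiddle`, a module this file deliberately does not import), with every
step a theorem of the tree EXCEPT the spreading:

* the pencil: a Bertini-general centre of two linear forms (`LinearSectionNet.exists_goodCentre`,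
  Hartshorne II Thm. 8.18) and its net of linear sections `X ←σ— X̃ —π→ ℙ¹` (`exists_goodPencil`,
  `Motives/LinearSectionNet{,Bertini}`, Hartshorne II Example 7.17.3): `X̃` smooth projective of
  dimension `m + 1`, fibres off the discriminant smooth projective `m`-folds
  (`FiberNet.exists_isClosed_forall_isSmoothProjective_fiber`, generic smoothness
  `FiberNet.smoothBase_nonempty_of_charZero`);
* the fibrewise hypothesis of the spreading fact is the Hodge conjecture on the `m`-folds `π⁻¹(t)`
  applied to `(π⁻¹(t) ⟶ X̃ ⟶ X)^* c` (rational, `IsRationalClass.map`; of type `(p,p)`,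
  `IsOfHodgeType.map_of_isSmoothProjective`);
* the spreading fact gives ONE algebraic rational `(p,p)`-class `a'` on `X̃` with
  `(σ^* c − a')|_{π⁻¹(t)} = 0` off a proper closed `S' ⊆ ℙ¹`, and a proper closed subset of `ℙ¹`
  misses a complex point (`exists_complexPoint_pt_not_mem`,
  `HodgeTheory/ArapuraSurfaceFibredFourfoldsProofs`);
* the descent `mem_algebraicClasses_of_pencil_spread` (`HodgeTheory/PencilSpreadDescent`: weak
  Lefschetz for `X̃ ⊂ X × ℙ¹` and for the smooth member, the incidence-divisor class, one rung of
  the coniveau ladder) concludes, using the statement in codimension `p − 1` on `X` itself — the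
  proof is a strong induction on `p` (`p = 0`: `algebraicClasses_zero`), which is where the printed
  proofs invoke "the summand `g_* α` is algebraic by induction".

* `mem_algebraicClasses_of_two_mul_le_of_spread_projectiveLine` — the step, granted the fact;
* `mem_algebraicClasses_of_two_mul_le_of_spread_supports_of_rigidity` — the step, granted the two
  leaves (I), (II).

## References

* [DecataldoMigliorini2009] M. A. de Cataldo, L. Migliorini, On singularities of primitive
  cohomology classes, Proc. AMS 137 (2009) 3593–3600, §4 Prop. 4.5 and its proof
  (arXiv:0711.1307v1, pp. 10–11).
* [Thomas2005Nodes] R. P. Thomas, Nodes and the Hodge conjecture, J. Algebraic Geom. 14 (2005)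
  177–185, §2 Prop. 2 and its proof (arXiv:math/0212216, p. 4).
* [VoisinHodgeII2003] C. Voisin, Hodge Theory and Complex Algebraic Geometry II (2003), §2.1.1,
  §2.3.1, §3.3.1, §10.2.1.
* [Hartshorne1977] R. Hartshorne, Algebraic Geometry (1977), II Example 7.17.3, II Thm. 8.18,
  III Cor. 10.7.
-/

noncomputable section

open CategoryTheory CategoryTheory.Limits AlgebraicGeometry
open Literature.AlgebraicTopology.SingularHomology
open Literature.AlgebraicGeometry.Motives

namespace Literature.AlgebraicGeometry.HodgeTheory

section HodgeTheory

/-- **The pencil step below the middle dimension, granted the pencil spreading fact.** If every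
rational `(q,q)`-class on every smooth projective complex `m`-fold is algebraic (all `q`), then for
`X` smooth projective of dimension `m + 1`, every rational `(p,p)`-class `c ∈ H²ᵖ(X(ℂ); ℂ)` with
`2p ≤ m` lies in `algebraicClasses X p` — granted `spread_algebraicClasses_over_projectiveLine`.
This is the body of the named fact `deCataldoMigliorini2009_mem_algebraicClasses_of_two_mul_le`
(de Cataldo–Migliorini 2009 §4, proof of Prop. 4.5; Thomas 2005, proof of Prop. 2, case `k < d/2`),
proved from the spreading fact by the printed architecture: Lefschetz pencil
(`LinearSectionNet.exists_goodCentre`, `exists_goodPencil`), Hodge conjecture on the smooth members, spreading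
(the fact), descent (`mem_algebraicClasses_of_pencil_spread`), by strong induction on `p`.
[cite: DecataldoMigliorini2009, §4 Prop. 4.5 and its proof (arXiv v1 pp. 10–11)]
[cite: Thomas2005Nodes, §2 Prop. 2 and its proof, case k < d/2 (p. 4)]
[cite: VoisinHodgeII2003, §2.1.1, §3.3.1 and §10.2.1] -/
theorem mem_algebraicClasses_of_two_mul_le_of_spread_projectiveLine
    (hSP : spread_algebraicClasses_over_projectiveLine) ⦃m : ℕ⦄ ⦃X : SchemeOver ℂ⦄
    (hX : IsSmoothProjective (m + 1) X)
    (hHC : ∀ ⦃Y : SchemeOver ℂ⦄, IsSmoothProjective m Y → ∀ (q : ℕ) (c : complexBetti Y (2 * q)),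
      IsRationalClass c → IsOfHodgeType m Y (2 * q) q q c → c ∈ algebraicClasses Y q)
    (p : ℕ) (c : complexBetti X (2 * p)) (hpm : 2 * p ≤ m) (hc : IsRationalClass c)
    (hpp : IsOfHodgeType (m + 1) X (2 * p) p p c) : c ∈ algebraicClasses X p := by
  revert c hpm
  induction p using Nat.strong_induction_on with
  | _ p ih =>
  intro c hpm hc hpp
  rcases p with _ | q
  · rw [algebraicClasses_zero]
    exact Submodule.mem_top
  -- the pencil: `a ≠ 0`, `X̃` smooth projective of dimension `m + 1`, good members off `T`
  obtain ⟨N, ι, hι⟩ := hX.isProjectiveOver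
  haveI := hι
  obtain ⟨a, ha, hXt, T, hT, hTne, hfib⟩ := exists_goodPencil hX ι (by omega)
  -- the fibrewise hypothesis: the Hodge conjecture on the members, applied to `(π⁻¹(s) ⟶ X)^* c`
  have halg : ∀ s : ComplexPoints (projectiveSpace 1 ℂ), s.pt ∉ T →
      complexBetti.map (fiberι (LinearSectionNet.proj ι a) s) (2 * (q + 1))
        (complexBetti.map (LinearSectionNet.blowDown ι a) (2 * (q + 1)) c) ∈
        algebraicClasses (fiberOver (LinearSectionNet.proj ι a) s) (q + 1) := by
    intro s hs
    have hYs : IsSmoothProjective m (fiberOver (LinearSectionNet.proj ι a) s) := hfib s hs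
    rw [← CategoryTheory.comp_apply, ← complexBetti.map_comp]
    exact hHC hYs (q + 1) _ (hc.map _) (hpp.map_of_isSmoothProjective hYs hX _)
  -- spreading
  obtain ⟨a', ha'N, ha'Q, ha'H, S', hS', hTS', hS'ne, hvan⟩ := hSP hXt (show 1 ≤ q + 1 by omega)
    (show q + 1 < m + 1 by omega) (LinearSectionNet.proj ι a) T hT hTne
    (fun s hs ↦ by rw [Nat.add_sub_cancel]; exact hfib s hs)
    (complexBetti.map (LinearSectionNet.blowDown ι a) (2 * (q + 1)) c) (hc.map _) halg
  -- one good member outside `S'`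
  obtain ⟨t, ht⟩ := exists_complexPoint_pt_not_mem hS' hS'ne
  have hY : IsSmoothProjective m (fiberOver (LinearSectionNet.proj ι a) t) := hfib t fun h ↦ ht (hTS' h)
  have hres : complexBetti.map (fiberι (LinearSectionNet.proj ι a) t) (2 * (q + 1)) a' =
      complexBetti.map (fiberι (LinearSectionNet.proj ι a) t ≫ LinearSectionNet.blowDown ι a)
        (2 * (q + 1)) c := by
    have h := hvan t ht
    rw [map_sub, sub_eq_zero] at h
    rw [← h, ← CategoryTheory.comp_apply, ← complexBetti.map_comp]
  -- descent, with the statement in codimension `q` on `X` as inductive hypothesis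
  exact mem_algebraicClasses_of_pencil_spread hX ι ha hXt hpm
    (fun c' hc'Q hc'H ↦ ih q (lt_add_one q) c' (by omega) hc'Q hc'H) c ha'N ha'Q ha'H t hY hres

/-- **The pencil step below the middle dimension, granted the two leaves** (I)
`spread_supports_over_projectiveLine` and (II) `vertical_rigidity_supportedClasses_projectiveLine`
of the spreading fact (`spread_algebraicClasses_of_supports_of_rigidity`).
[cite: DecataldoMigliorini2009, §4 Prop. 4.5 and its proof (arXiv v1 pp. 10–11)]
[cite: VoisinHodgeII2003, §3.3.1 and §10.2.1] -/
theorem mem_algebraicClasses_of_two_mul_le_of_spread_supports_of_rigidity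
    (hI : spread_supports_over_projectiveLine) (hII : vertical_rigidity_supportedClasses_projectiveLine)
    ⦃m : ℕ⦄ ⦃X : SchemeOver ℂ⦄ (hX : IsSmoothProjective (m + 1) X)
    (hHC : ∀ ⦃Y : SchemeOver ℂ⦄, IsSmoothProjective m Y → ∀ (q : ℕ) (c : complexBetti Y (2 * q)),
      IsRationalClass c → IsOfHodgeType m Y (2 * q) q q c → c ∈ algebraicClasses Y q)
    (p : ℕ) (c : complexBetti X (2 * p)) (hpm : 2 * p ≤ m) (hc : IsRationalClass c)
    (hpp : IsOfHodgeType (m + 1) X (2 * p) p p c) : c ∈ algebraicClasses X p :=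
  mem_algebraicClasses_of_two_mul_le_of_spread_projectiveLine
    (spread_algebraicClasses_of_supports_of_rigidity hI hII) hX hHC p c hpm hc hpp

end HodgeTheory

end Literature.AlgebraicGeometry.HodgeTheory

end
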